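import Mathlib
import Summits.Parity.GeneralizedHardyLittlewood.Theses.LiouvilleShiftedTables
import Summits.Parity.GeneralizedHardyLittlewood.Theorems.TableChowla.Negative.TableChowlaExceptionalSet
import Summits.Parity.GeneralizedHardyLittlewood.Theorems.LiouvilleShiftedTablesTableChowlaPeriodicOfBVAux

/-!
# `stub_periodic_of_bv` — the periodic residual of line `helson-kronecker-inverse` from BV for `λ`

Crux `LiouvilleShiftedTables.TableChowla` (stmt-Parity-14270), line `helson-kronecker-inverse`,
registered stub `stub_periodic_of_bv`: the mean-square dispersion of the shifted multiplication
table `(λ(ab+c))` against `q`-periodic 1-bounded column weights `g`, `q ≤ (log x)^K`, is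
`≤ x·(x/A)/(log x)^C`, GIVEN Bombieri–Vinogradov for `λ` (`BVLiouville`, the route's support item
stmt-Parity-13324, taken as a hypothesis).

Proof (pure bookkeeping, lemmas in `…PeriodicOfBVAux`). Split `b ≤ ⌊y⌋` into classes `r mod q`;
on a class `g` is constant, so `‖∑_b g(b)λ(ab+c)‖ ≤ ∑_{r<q} |S(a,r)|`,
`S(a,r) = ∑_{b ≡ r (q)} λ(ab+c)` (`norm_sum_periodic_le`). Each `S(a,r)` is `λ` along ONE
progression of modulus `d = aq` with a residue in `[0, d)` and at most one boundary term:
`|S(a,r)| ≤ |∑_{n ≤ m} λ(dn + ρ)| + 1` with `d·m ≤ a⌊y⌋ ≤ 2x` (`periodic_classSum_le`, the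
registered sub-goal of the auxiliary file). Distinct rows give distinct moduli
`aq ≤ 2x^{5/12}(log x)^K ≤ (2x)^{11/24}`, so for each fixed `r` the sum over the rows is ONE
instance of `BVLiouville` at scale `2x`, `ε = 1/24`, exponent `C + K + 1`
(`sum_rows_bvInner_le`). With the trivial bound `‖∑_b g(b)λ(ab+c)‖ ≤ ⌊y⌋ ≤ x/A` on the other
factor of the square, the total is `≤ (x/A)·q·(2C_bv x/(log x)^{C+K+1} + 2A) ≤ x(x/A)/(log x)^C`
for large `x` (`final_bound`).
-/

namespace Summit.Parity.GeneralizedHardyLittlewood.Theorems.TableChowla.HelsonKroneckerInverse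

open Finset ArithmeticFunction
open Summit.Parity.GeneralizedHardyLittlewood.Theses.LiouvilleShiftedTables
open PeriodicOfBV

noncomputable section

/-- **`stub_periodic_of_bv`** (registered stub of line `helson-kronecker-inverse`, crux
stmt-Parity-14270): Bombieri–Vinogradov for `λ` (`BVLiouville`, hypothesis) implies the periodic
part of the mean-square residual — for `q`-periodic 1-bounded weights `g`, `1 ≤ q ≤ (log x)^K`,
`∑_{a ∈ (⌊A⌋,⌊2A⌋]} ‖∑_{b ≤ ⌊y⌋} g(b) λ(ab+c)‖² ≤ x·(x/A)/(log x)^C` for `x ≥ x₀(c,δ,C,K)`,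
uniformly for `x^δ ≤ A ≤ x^{1/3+δ}` and `y ≤ x/A`. (Complete multiplicativity of `g` and `c ≠ 0`
are not used.) -/
theorem stub_periodic_of_bv :
    Summit.Parity.GeneralizedHardyLittlewood.Theses.LiouvilleShiftedTables.BVLiouville →
    ∀ c : ℤ, c ≠ 0 → ∀ δ : ℝ, 0 < δ → δ ≤ 1 / 12 → ∀ C : ℝ, 0 < C → ∀ K : ℝ, 0 < K → ∃ x₀ : ℝ,
    ∀ x : ℝ, x₀ ≤ x → ∀ A : ℝ, x ^ δ ≤ A → A ≤ x ^ (1 / 3 + δ) →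
    ∀ g : ℕ → ℂ, (∀ m n : ℕ, g (m * n) = g m * g n) → (∀ n : ℕ, ‖g n‖ ≤ 1) →
    ∀ q : ℕ, 1 ≤ q → (q : ℝ) ≤ Real.log x ^ K → Function.Periodic g q →
    ∀ y : ℝ, y ≤ x / A →
      ∑ a ∈ Finset.Ioc ⌊A⌋₊ ⌊2 * A⌋₊,
          ‖∑ b ∈ Finset.Icc 1 ⌊y⌋₊, g b *
            ((ArithmeticFunction.liouville (Int.toNat ((a : ℤ) * b + c)) : ℝ) : ℂ)‖ ^ 2 ≤
        x * (x / A) / Real.log x ^ C := by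
  intro hBV c _ δ hδ hδ12 C hC K hK
  -- ONE instance of Bombieri–Vinogradov: `ε = 1/24`, exponent `C + K + 1`
  obtain ⟨Cbv, xbv, hbv⟩ := hBV (1 / 24) (by norm_num) (C + K + 1) (by linarith)
  set Cb : ℝ := max Cbv 1 with hCb_def
  have hCb1 : 1 ≤ Cb := le_max_right _ _
  have hCbv : Cbv ≤ Cb := le_max_left _ _
  -- eventualities in `x`
  obtain ⟨X₁, hX₁⟩ := Negative.eventually_log_rpow_le (show (0 : ℝ) < 1 / 24 by norm_num) K
  obtain ⟨X₂, hX₂⟩ := Negative.eventually_log_rpow_le (show (0 : ℝ) < 7 / 12 by norm_num) (K + C)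
  obtain ⟨X₃, hX₃⟩ := Negative.eventually_log_rpow_le hδ 1
  obtain ⟨X₄, hX₄⟩ := Negative.eventually_rpow_log_ge one_pos (max (4 * Cb) (|c| : ℝ))
  refine ⟨max (max (max X₁ X₂) (max X₃ X₄)) (max xbv 1), ?_⟩
  intro x hx A hA hA' g _ hg1 q hq hqK hper y hy
  simp only [max_le_iff] at hx
  obtain ⟨⟨⟨hx1', hx2'⟩, ⟨hx3', hx4'⟩⟩, ⟨hxbv, hx1⟩⟩ := hx
  obtain ⟨hlogK, hL2⟩ := hX₁ x hx1'
  obtain ⟨hlogKC, -⟩ := hX₂ x hx2'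
  obtain ⟨hlog1, -⟩ := hX₃ x hx3'
  obtain ⟨hlogc, -⟩ := hX₄ x hx4'
  rw [Real.rpow_one] at hlog1 hlogc
  set L := Real.log x with hL_def
  have hxpos : 0 < x := by linarith
  have hL0 : 0 < L := by linarith
  have hA1 : 1 ≤ A := (Real.one_le_rpow hx1 hδ.le).trans hA
  have hApos : 0 < A := by linarith
  have hcL : (|c| : ℝ) ≤ L := (le_max_right _ _).trans hlogc
  have hCbL : 4 * Cb ≤ L := (le_max_left _ _).trans hlogc
  have hcA : (|c| : ℝ) + 1 ≤ A := by linarith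
  -- window sizes: `A ≤ x^{5/12}`, `x/A ≥ x^{7/12} ≥ 4 L^{K+C}`
  have hx512 : x ^ (1 / 3 + δ) ≤ x ^ ((5 : ℝ) / 12) :=
    Real.rpow_le_rpow_of_exponent_le hx1 (by linarith)
  have hA512 : A ≤ x ^ ((5 : ℝ) / 12) := hA'.trans hx512
  have hxA : x ^ ((7 : ℝ) / 12) ≤ x / A := by
    calc x ^ ((7 : ℝ) / 12) = x ^ ((1 : ℝ) - 5 / 12) := by norm_num
      _ = x / x ^ ((5 : ℝ) / 12) := by rw [Real.rpow_sub hxpos, Real.rpow_one]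
      _ ≤ x / A := div_le_div_of_nonneg_left hxpos.le hApos hA512
  have hwin : 4 * L ^ (K + C) ≤ x / A := hlogKC.trans hxA
  -- the columns `Y = ⌊y⌋ ≤ x/A`
  set Y := ⌊y⌋₊ with hY_def
  have hYle : (Y : ℝ) ≤ x / A := by
    rcases le_or_gt 0 y with hy0 | hy0
    · exact (Nat.floor_le hy0).trans hy
    · rw [hY_def, Nat.floor_of_nonpos hy0.le, Nat.cast_zero]; positivity
  -- the rows `a ∈ (⌊A⌋, ⌊2A⌋]`: `A < a ≤ 2A`, `|c| < a`, `#rows ≤ 2A`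
  set rows := Ioc ⌊A⌋₊ ⌊2 * A⌋₊ with hrows_def
  have hrowA : ∀ a ∈ rows, A < (a : ℝ) ∧ (a : ℝ) ≤ 2 * A := by
    intro a ha
    rw [hrows_def, mem_Ioc] at ha
    constructor
    · have h1 : A < (⌊A⌋₊ : ℝ) + 1 := Nat.lt_floor_add_one A
      have h2 : ((⌊A⌋₊ + 1 : ℕ) : ℝ) ≤ a := by exact_mod_cast ha.1
      push_cast at h2; linarith
    · exact le_trans (by exact_mod_cast ha.2) (Nat.floor_le (by linarith))
  have hrows_pos : ∀ a ∈ rows, 0 < a := by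
    intro a ha
    have h0 : (0 : ℝ) < a := by linarith [(hrowA a ha).1]
    exact_mod_cast h0
  have hca : ∀ a ∈ rows, |c| < (a : ℤ) := by
    intro a ha
    have h : ((|c| : ℤ) : ℝ) < ((a : ℤ) : ℝ) := by push_cast; linarith [(hrowA a ha).1]
    exact_mod_cast h
  have hR : ((rows.card : ℕ) : ℝ) ≤ 2 * A := by
    rw [hrows_def, Nat.card_Ioc, Nat.cast_sub (Nat.floor_le_floor (by linarith : A ≤ 2 * A))]
    have h1 : (⌊2 * A⌋₊ : ℝ) ≤ 2 * A := Nat.floor_le (by linarith)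
    have h2 : A - 1 < (⌊A⌋₊ : ℝ) := by have := Nat.lt_floor_add_one A; linarith
    linarith
  -- the BV scale `X = 2x` and the moduli `aq ≤ ⌊X^{1/2 - 1/24}⌋`
  set X : ℝ := 2 * x with hX_def
  have hX0 : 0 ≤ X := by positivity
  have hD : ∀ a ∈ rows, a * q ≤ ⌊X ^ ((1 : ℝ) / 2 - 1 / 24)⌋₊ := by
    intro a ha
    apply Nat.le_floor
    have ha2 : (a : ℝ) ≤ 2 * x ^ ((5 : ℝ) / 12) := by linarith [(hrowA a ha).2]
    have hq' : (q : ℝ) ≤ x ^ ((1 : ℝ) / 24) / 4 := by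
      rw [le_div_iff₀ (by norm_num : (0 : ℝ) < 4)]; linarith
    calc ((a * q : ℕ) : ℝ) = (a : ℝ) * q := by push_cast; ring
      _ ≤ (2 * x ^ ((5 : ℝ) / 12)) * (x ^ ((1 : ℝ) / 24) / 4) :=
          mul_le_mul ha2 hq' (by positivity) (by positivity)
      _ = x ^ ((5 : ℝ) / 12) * x ^ ((1 : ℝ) / 24) / 2 := by ring
      _ ≤ x ^ ((5 : ℝ) / 12) * x ^ ((1 : ℝ) / 24) := half_le_self (by positivity)
      _ = x ^ ((1 : ℝ) / 2 - 1 / 24) := by rw [← Real.rpow_add hxpos]; norm_num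
      _ ≤ X ^ ((1 : ℝ) / 2 - 1 / 24) := Real.rpow_le_rpow hxpos.le (by linarith) (by norm_num)
  -- BV at scale `X`, and the size of its bound
  have hBVX := hbv X (by linarith)
  have hBle : Cbv * X / Real.log X ^ (C + K + 1) ≤ Cb * (2 * x) / L ^ (C + K + 1) := by
    have hlogX : L ≤ Real.log X := Real.log_le_log hxpos (by linarith)
    have hpow : L ^ (C + K + 1) ≤ Real.log X ^ (C + K + 1) :=
      Real.rpow_le_rpow hL0.le hlogX (by linarith)
    have hLp : 0 < L ^ (C + K + 1) := Real.rpow_pos_of_pos hL0 _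
    calc Cbv * X / Real.log X ^ (C + K + 1) ≤ Cb * X / Real.log X ^ (C + K + 1) :=
          div_le_div_of_nonneg_right (mul_le_mul_of_nonneg_right hCbv hX0) (hLp.le.trans hpow)
      _ ≤ Cb * X / L ^ (C + K + 1) := div_le_div_of_nonneg_left (by positivity) hLp hpow
  -- Step 1: each row, `‖T_a‖² ≤ Y · ∑_r |S(a,r)|`
  have hstep1 : ∀ a ∈ rows,
      ‖∑ b ∈ Icc 1 Y, g b * ((liouville (Int.toNat ((a : ℤ) * b + c)) : ℝ) : ℂ)‖ ^ 2 ≤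
        (Y : ℝ) * ∑ r ∈ range q, |∑ b ∈ (Icc 1 Y).filter (fun b => b % q = r),
          (liouville (Int.toNat ((a : ℤ) * b + c)) : ℝ)| := by
    intro a _
    rw [sq]
    exact mul_le_mul (norm_sum_le_card hg1 c Y a)
      (norm_sum_periodic_le hq hper hg1 (Icc 1 Y)
        (fun b => (liouville (Int.toNat ((a : ℤ) * b + c)) : ℝ)))
      (norm_nonneg _) (Nat.cast_nonneg Y)
  -- Step 2: each residue class `r` is ONE instance of BV over the rows
  have hstep2 : ∀ r ∈ range q,
      ∑ a ∈ rows, |∑ b ∈ (Icc 1 Y).filter (fun b => b % q = r),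
          (liouville (Int.toNat ((a : ℤ) * b + c)) : ℝ)| ≤
        Cbv * X / Real.log X ^ (C + K + 1) + rows.card := by
    intro r hr
    rw [mem_range] at hr
    choose! ρ m hρ0 hρlt hmY hSle using
      fun a (ha : a ∈ rows) => periodic_classSum_le c q Y a r hq hr (hca a ha)
    have hm : ∀ a ∈ rows, ((a * q : ℕ) : ℝ) * m a ≤ X := by
      intro a ha
      have h1 : ((q * m a : ℕ) : ℝ) ≤ Y := by exact_mod_cast hmY a ha
      calc ((a * q : ℕ) : ℝ) * m a = (a : ℝ) * ((q * m a : ℕ) : ℝ) := by push_cast; ring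
        _ ≤ (2 * A) * (x / A) :=
            mul_le_mul (hrowA a ha).2 (h1.trans hYle) (by positivity) (by positivity)
        _ = X := by rw [hX_def]; field_simp
    calc ∑ a ∈ rows, |∑ b ∈ (Icc 1 Y).filter (fun b => b % q = r),
            (liouville (Int.toNat ((a : ℤ) * b + c)) : ℝ)|
        ≤ ∑ a ∈ rows,
            (|∑ n ∈ Icc 1 (m a), (liouville (Int.toNat (((a * q : ℕ) : ℤ) * n + ρ a)) : ℝ)| + 1) :=
          sum_le_sum fun a ha => hSle a ha
      _ = ∑ a ∈ rows,
            |∑ n ∈ Icc 1 (m a), (liouville (Int.toNat (((a * q : ℕ) : ℤ) * n + ρ a)) : ℝ)| +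
            rows.card := by
          rw [sum_add_distrib, sum_const, nsmul_eq_mul, mul_one]
      _ ≤ Cbv * X / Real.log X ^ (C + K + 1) + rows.card :=
          add_le_add (sum_rows_bvInner_le hq hrows_pos hD hX0 ρ m
            (fun a ha => ⟨hρ0 a ha, hρlt a ha⟩) hm hBVX) le_rfl
  -- Step 3: assemble
  have hq0 : (0 : ℝ) ≤ q := Nat.cast_nonneg q
  calc ∑ a ∈ rows, ‖∑ b ∈ Icc 1 Y, g b * ((liouville (Int.toNat ((a : ℤ) * b + c)) : ℝ) : ℂ)‖ ^ 2
      ≤ ∑ a ∈ rows, ((Y : ℝ) * ∑ r ∈ range q, |∑ b ∈ (Icc 1 Y).filter (fun b => b % q = r),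
          (liouville (Int.toNat ((a : ℤ) * b + c)) : ℝ)|) :=
        sum_le_sum hstep1
    _ = (Y : ℝ) * ∑ r ∈ range q, ∑ a ∈ rows, |∑ b ∈ (Icc 1 Y).filter (fun b => b % q = r),
          (liouville (Int.toNat ((a : ℤ) * b + c)) : ℝ)| := by
        rw [← mul_sum, sum_comm]
    _ ≤ (Y : ℝ) * ∑ _r ∈ range q, (Cbv * X / Real.log X ^ (C + K + 1) + rows.card) :=
        mul_le_mul_of_nonneg_left (sum_le_sum hstep2) (Nat.cast_nonneg Y)
    _ = (Y : ℝ) * (q * (Cbv * X / Real.log X ^ (C + K + 1) + rows.card)) := by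
        rw [sum_const, card_range, nsmul_eq_mul]
    _ ≤ (Y : ℝ) * (q * (Cb * (2 * x) / L ^ (C + K + 1) + rows.card)) :=
        mul_le_mul_of_nonneg_left (mul_le_mul_of_nonneg_left (add_le_add hBle le_rfl) hq0)
          (Nat.cast_nonneg Y)
    _ ≤ x * (x / A) / L ^ C :=
        final_bound hxpos hApos hL0 hYle hq0 hqK (by linarith) hCbL (Nat.cast_nonneg _) hR hwin

end

end Summit.Parity.GeneralizedHardyLittlewood.Theorems.TableChowla.HelsonKroneckerInverse
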